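import Literature.NumberTheory.GaloisRepresentations.ContinuousCohomologyMultiplicationSequences
import Literature.NumberTheory.GaloisRepresentations.ContinuousCohomologyCofiniteGeneration
import Literature.NumberTheory.GaloisRepresentations.ContinuousH1FiniteOfBoundedIndex
import Literature.NumberTheory.GaloisRepresentations.InertiaCohomologyTorsionBound
import Literature.NumberTheory.GaloisRepresentations.ContinuousCohomologyAdditiveTransport
import Literature.NumberTheory.GaloisRepresentations.LabelledHodgeTateWeights
import Literature.NumberTheory.GaloisRepresentations.LocalGaloisGroupProofs
import Literature.NumberTheory.EllipticCurves.BigGaloisRepSelmer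
import Literature.NumberTheory.EllipticCurves.SkinnerUrban2014.CofinitelyGeneratedSelmerProofs
import Literature.Algebra.Module.CharacterModuleCoNakayama
import Summits.BirchSwinnertonDyer.BirchSwinnertonDyer.Theorems.ErratumRoadFiveSigmaLocalMultQuotient
import Summits.BirchSwinnertonDyer.BirchSwinnertonDyer.Theorems.ThetaPartnerAtTwoSignedMainConjectureCMTwoRankZeroPTDeepAdditiveInertia
import HarnessLib

/-!
# Crux 4 `BSDpOnCellC` (stmt-BirchSwinnertonDyer-19034), line `telescope`, leaf N2 / sub-leaf W2: THE FROBENIUS ANNIHILATOR ON THE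
# INERTIA INVARIANTS — a monic `P` with `P(ρ(d)) · A^{I_F} ⊆ c · A^{I_F}` for every `d ∈ Γ_F`, from the cofinite generation of
# `H¹(I_F, A[c])` (helper, `--supports stmt-BirchSwinnertonDyer-19034 --as helper`; closes nothing; NOT the registered text)

Cell `bsd-eis`, width seat `bsd-line-x2-p2` (prover g20, 2026-08-30; D-0154 KEY row 5). THEOREMS ONLY: no definition, no named fact,
no `sorry`, no instance, no notation. GENERIC CORE of the discharge of hypothesis (ann) of p752662
`TelescopeK2WeightTwoControlMapOfFrobenius.exists_weightTwoControlMap_of_frobenius_of_split` («for every bad `w ∤ p` and every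
`d ∈ Γ_{K_w}`, a MONIC `P` with `P(ρ₂(res d)) · A₂^{I_w} ⊆ X · A₂^{I_w}»); the number-field instantiation is the sibling file
`…TelescopeK2InertiaFrobeniusAnnihilatorBranch`.

SETTING: `F` a non-archimedean local field of residue characteristic `ℓ ≠ p`; `𝒪` a `ℤ_p`-algebra with ANY topology (the statements do
not see it: cohomology is taken with `ℤ_p`-coefficients after `restrictScalars`, `ℤ_p` acting continuously on every discrete `p`-primary
module); `A` a discrete `𝒪`-module with a continuous `𝒪`-linear `Γ_F`-action `ρ`; `c ∈ 𝒪` acting surjectively on `A`; `A` `p`-primary with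
`A[c][p]` finite. THE CLASSICAL ARGUMENT: (§4) `H¹(I_F, A[c])` is a cofinitely generated `ℤ_p`-module — its `p`-torsion sits between
`H¹(I_F, A[c][p])`, finite by the tame structure of `I_F` (tree `natCard_continuousCohomology_one_absInertia_le`), and `H⁰(I_F, A[c]/p)`
(Greenberg's dévissage, tree `module_finite_characterModule_torsionBy_continuousCohomology`), every class is `p`-power torsion, and Nakayama
for Pontryagin duals (tree `CharacterModule.module_finite_of_finite_torsionBySet`) applies; (§5) the connecting homomorphism of
`0 → A[c] → A →(c·) A → 0` over `I_F` (tree `IsSES.δ₀`) embeds `M₀ = A^{I_F}/c·A^{I_F}` into it, so `M₀^∨` is a finitely generated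
`ℤ_p`-module on which `ρ(d)` acts (`I_F ⊴ Γ_F`, tree `absInertia_normal_holds`); (§2) Cayley–Hamilton on `M₀^∨` (Mathlib
`LinearMap.exists_monic_and_aeval_eq_zero`) and separation of points by characters give the monic annihilator.

* §1 `apply_aeval_eq_aeval_apply`, `characterModule_aeval_dual_apply` — polynomials in an endomorphism along intertwiners / on the dual.
* §2 `exists_monic_forall_exists_eq_aeval_of_ker_eq` — PURE ALGEBRA: commuting `δ, γ ∈ End_R(N)`, an `R`-linear `φ : N → H` with
  `ker φ = γN` and `H^∨` finitely generated ⇒ a monic `P ∈ R[Y]` with `P(δ) N ⊆ γ N`.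
* §3 `ℤ_p`-bookkeeping (`p`-power torsion in three currencies).
* §4 `module_finite_characterModule_h1_absInertia` — `H¹(I_F, D)^∨` is finitely generated over `ℤ_p` for `D` discrete `p`-primary with
  `D[p]` finite, `ℓ ≠ p`.
* §5 **`exists_monic_aeval_restrictScalars_inertiaInvariants_mem`** — THE ANNIHILATOR: for every `d ∈ Γ_F` a monic `P ∈ ℤ_p[Y]` with
  `P(ρ d) a ∈ c · A^{I_F}` for every `a ∈ A^{I_F}`.

HONEST FRAMING: local Galois-cohomology bookkeeping over tree theorems; nothing about any curve; no registered stub, crux or summit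
statement is proved by this file; closes: none.

References: [JetchevSkinnerWan2017] §3.4, proof of Lemma 3.4.1 (arXiv:1512.06894 p. 14); [GreenbergVatsal2000] §2, proof of Prop. 2.4;
[Greenberg2006] §3 A, Prop. 3.2 and proof (pp. 358–359); [SerreGaloisCohomology1997] I §2.2; [SerreLocalFields1979] IV §2, XIII §1;
[MilneADT2006] I §2 Lemma 2.9; [Washington1997] Lemma 13.16; [AtiyahMacdonald1969] Prop. 2.4 (Cayley–Hamilton for modules).
-/

noncomputable section

-- D-0017: single-problem summit, the namespace repeats the problem name by design.
set_option linter.dupNamespace false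
set_option autoImplicit false

open Field Function
open Literature.NumberTheory.GaloisRepresentations Literature.NumberTheory.EllipticCurves.BigGaloisRep
  Literature.Algebra.Module Literature.NumberTheory.EllipticCurves.SkinnerUrban2014

universe u

namespace Summit.BirchSwinnertonDyer.BirchSwinnertonDyer.Theorems.TelescopeK2InertiaFrobeniusAnnihilator

/-! ## §1 Polynomials in an endomorphism along intertwining maps and on the Pontryagin dual -/

section Algebra

variable {R : Type*} [CommRing R] {N : Type*} [AddCommGroup N] [Module R N] {N' : Type*} [AddCommGroup N'] [Module R N']

/-- **An additive `R`-homogeneous map intertwining `δ` and `δ'` intertwines `P(δ)` and `P(δ')`** (`g (P(δ) m) = P(δ') (g m)`).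
[folklore] [cite: AtiyahMacdonald1969, Prop. 2.4 (polynomials in an endomorphism)] -/
theorem apply_aeval_eq_aeval_apply (δ : Module.End R N) (δ' : Module.End R N') (g : N →ₗ[R] N')
    (h : ∀ m : N, g (δ m) = δ' (g m)) (P : Polynomial R) (m : N) :
    g (Polynomial.aeval δ P m) = Polynomial.aeval δ' P (g m) := by
  have hpow : ∀ (n : ℕ) (m : N), g ((δ ^ n) m) = (δ' ^ n) (g m) := by
    intro n
    induction n with
    | zero => intro m; rfl
    | succ n ih => intro m; rw [pow_succ', pow_succ', Module.End.mul_apply, Module.End.mul_apply, h, ih]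
  induction P using Polynomial.induction_on' with
  | add P Q hP hQ => rw [map_add, map_add, LinearMap.add_apply, LinearMap.add_apply, map_add, hP, hQ]
  | monomial n r =>
    rw [Polynomial.aeval_monomial, Polynomial.aeval_monomial, Module.End.mul_apply, Module.End.mul_apply,
      Module.algebraMap_end_apply, Module.algebraMap_end_apply, map_smul, hpow]

/-- **`(P(δ^∨) χ)(m) = χ (P(δ) m)`** for the Pontryagin-dual endomorphism `δ^∨ = CharacterModule.dual δ` (`χ ↦ χ ∘ δ`).
[folklore] [cite: Washington1997, Lemma 13.16 (duality bookkeeping)] -/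
theorem characterModule_aeval_dual_apply (δ : Module.End R N) (P : Polynomial R) (χ : CharacterModule N) (m : N) :
    (Polynomial.aeval (CharacterModule.dual δ) P χ) m = χ (Polynomial.aeval δ P m) := by
  have hpow : ∀ (n : ℕ) (χ : CharacterModule N) (m : N), ((CharacterModule.dual δ ^ n) χ) m = χ ((δ ^ n) m) := by
    intro n
    induction n with
    | zero => intro χ m; rfl
    | succ n ih =>
      intro χ m
      rw [pow_succ, pow_succ', Module.End.mul_apply, Module.End.mul_apply, ih]
      rfl
  induction P using Polynomial.induction_on' generalizing m with
  | add P Q hP hQ =>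
    rw [map_add, map_add, LinearMap.add_apply, LinearMap.add_apply, map_add, ← hP, ← hQ]
    rfl
  | monomial n r =>
    rw [Polynomial.aeval_monomial, Polynomial.aeval_monomial, Module.End.mul_apply, Module.End.mul_apply,
      Module.algebraMap_end_apply, Module.algebraMap_end_apply, CharacterModule.smul_apply, hpow, map_smul]

/-! ## §2 Cayley–Hamilton on the Pontryagin dual: a monic annihilator modulo `γ` -/

/-- **A monic `P ∈ R[Y]` with `P(δ) N ⊆ γ N`.** `δ, γ ∈ End_R(N)` commute and an `R`-linear `φ : N → H` with `ker φ = γ N` lands in a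
module with finitely generated Pontryagin dual `H^∨ = Hom(H, ℚ/ℤ)`. Then `δ` descends to `M₀ = N/γN ↪ H`, the dual `M₀^∨` (a quotient of
`H^∨`) is finitely generated and carries `δ^∨`; Cayley–Hamilton for finitely generated modules gives a monic `P` with `P(δ^∨) = 0`, i.e.
`χ(P(δ) m) = 0` for every character `χ`, and characters separate points.
[cite: AtiyahMacdonald1969, Prop. 2.4 (Cayley–Hamilton for finitely generated modules)] [cite: Washington1997, Lemma 13.16] -/
theorem exists_monic_forall_exists_eq_aeval_of_ker_eq (δ γ : Module.End R N) (hcomm : ∀ m : N, δ (γ m) = γ (δ m))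
    {H : Type*} [AddCommGroup H] [Module R H] (φ : N →ₗ[R] H) (hφ : ∀ v : N, φ v = 0 ↔ v ∈ LinearMap.range γ)
    [Module.Finite R (CharacterModule H)] :
    ∃ P : Polynomial R, P.Monic ∧ ∀ v : N, ∃ v₀ : N, γ v₀ = Polynomial.aeval δ P v := by
  set Q : Submodule R N := LinearMap.range γ with hQ
  have hle : Q ≤ LinearMap.ker φ := fun v hv => (hφ v).2 hv
  have hinj : Function.Injective (Q.liftQ φ hle) :=
    LinearMap.ker_eq_bot.1 (Submodule.ker_liftQ_eq_bot Q φ hle fun v hv => (hφ v).1 hv)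
  haveI : Module.Finite R (CharacterModule (N ⧸ Q)) :=
    Module.Finite.of_surjective (CharacterModule.dual (Q.liftQ φ hle)) (CharacterModule.dual_surjective_of_injective _ hinj)
  have hQδ : Q ≤ Q.comap δ := by
    rintro - ⟨w, rfl⟩
    exact ⟨δ w, (hcomm w).symm⟩
  set δM : Module.End R (N ⧸ Q) := Q.mapQ Q δ hQδ with hδM
  obtain ⟨P, hPmon, hP⟩ := LinearMap.exists_monic_and_aeval_eq_zero R (CharacterModule.dual δM)
  refine ⟨P, hPmon, fun v => ?_⟩
  -- `P(δM) = 0` on `N/Q` (characters separate points), hence `P(δ) v ∈ Q = γ N`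
  have hM : Polynomial.aeval δM P (Q.mkQ v) = 0 := by
    by_contra hne
    obtain ⟨χ, hχ⟩ := CharacterModule.exists_character_apply_ne_zero_of_ne_zero hne
    refine hχ ?_
    rw [← characterModule_aeval_dual_apply, hP, LinearMap.zero_apply]
    rfl
  have hmk : Q.mkQ (Polynomial.aeval δ P v) = 0 := by
    rw [apply_aeval_eq_aeval_apply δ δM Q.mkQ (fun m => rfl) P v]
    exact hM
  rw [Submodule.mkQ_apply, Submodule.Quotient.mk_eq_zero] at hmk
  obtain ⟨v₀, hv₀⟩ := hmk
  exact ⟨v₀, hv₀⟩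

end Algebra

/-! ## §3 Over `ℤ_p`: every element killed by a power of `p`, in the three currencies -/

section Primary

variable {p : ℕ} [Fact p.Prime]

/-- `p^k • d = 0` (natural-number multiple) ⇒ `(p : ℤ_p)^k • d = 0`. [folklore] -/
theorem padicInt_pow_smul_eq_zero {D : Type*} [AddCommGroup D] [Module ℤ_[p] D] {d : D} {k : ℕ} (h : p ^ k • d = 0) :
    (p : ℤ_[p]) ^ k • d = 0 := by
  rw [← Nat.cast_pow, Nat.cast_smul_eq_nsmul, h]

/-- `p^k • d = 0` ⇒ every element of `𝔪^k = (p^k) ⊆ ℤ_p` kills `d`. [folklore] -/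
theorem forall_mem_maximalIdeal_pow_smul_eq_zero {D : Type*} [AddCommGroup D] [Module ℤ_[p] D] {d : D} {k : ℕ}
    (h : p ^ k • d = 0) : ∀ r ∈ IsLocalRing.maximalIdeal ℤ_[p] ^ k, r • d = 0 := by
  intro r hr
  rw [PadicInt.maximalIdeal_eq_span_p, Ideal.span_singleton_pow, Ideal.mem_span_singleton'] at hr
  obtain ⟨a, rfl⟩ := hr
  rw [mul_smul, padicInt_pow_smul_eq_zero h, smul_zero]

/-- `𝔪 = (p) ⊆ ℤ_p` is generated by the one-term family `![p]`. [folklore] -/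
theorem span_range_padic_eq_maximalIdeal :
    Ideal.span (Set.range ![(p : ℤ_[p])]) = IsLocalRing.maximalIdeal ℤ_[p] := by
  rw [PadicInt.maximalIdeal_eq_span_p, Matrix.range_cons, Matrix.range_empty, Set.union_empty]

end Primary

/-! ## §4 `H¹(I_F, D)` is a cofinitely generated `ℤ_p`-module for `D` discrete, `p`-primary with finite `p`-torsion, `ℓ ≠ p` -/

section Inertia

open Literature.NumberTheory.GaloisRepresentations.IsNonarchimedeanLocalField

variable (F : Type) [Field F] [ValuativeRel F] [TopologicalSpace F] [IsNonarchimedeanLocalField F]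
  {p : ℕ} [Fact p.Prime]
  {D : Type} [AddCommGroup D] [Module ℤ_[p] D] [TopologicalSpace D] [DiscreteTopology D] [ContinuousSMul ℤ_[p] D]

/-- **`H¹(I_F, D)^∨` is a finitely generated `ℤ_p`-module** for a discrete `ℤ_p`-linear `Γ_F`-representation `D` every element of which is
killed by a power of `p`, with `D[p]` finite, at residue characteristic `ℓ ≠ p`. PROOF (Greenberg 2006, Prop. 3.2, for `Γ = I_F` in degree
`1`): `D^∨` is finitely generated (topological Nakayama, tree `module_finite_characterModule_of_torsion_finite`), hence `D/pD`
is finite; `H¹(I_F, D[p])` is finite (tame structure of `I_F`, tree `natCard_continuousCohomology_one_absInertia_le`, the order of `D[p]`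
being a power of `p ≠ ℓ`) and `H⁰(I_F, D/pD)` is finite, so `(H¹(I_F, D)[p])^∨` is finitely generated (tree dévissage
`module_finite_characterModule_torsionBy_continuousCohomology`), i.e. `H¹(I_F, D)[p]` is finite; every class is killed by a power of `p`
(tree `exists_forall_mem_pow_smul_continuousCohomology_eq_zero`), and Nakayama for Pontryagin duals
(tree `CharacterModule.module_finite_of_finite_torsionBySet`) concludes.
[cite: Greenberg2006, §3 A, Prop. 3.2 and proof (pp. 358–359)] [cite: SerreLocalFields1979, Ch. IV §2, Ch. XIII §1 Prop. 1]
[cite: MilneADT2006, I §2 Lemma 2.9] [cite: GreenbergVatsal2000, §2, proof of Prop. 2.4] -/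
theorem module_finite_characterModule_h1_absInertia (hℓ : ringChar (IsLocalRing.ResidueField (ValuativeRel.valuation F).integer) ≠ p)
    (τ : ContinuousRep (absoluteGaloisGroup F) ℤ_[p] D) (hD : ∀ d : D, ∃ k : ℕ, p ^ k • d = 0)
    (hfin : {d : D | p • d = 0}.Finite) :
    Module.Finite ℤ_[p] (CharacterModule
      (continuousCohomology 1 (τ.restrict (subgroupIncl (absInertia F))).toTopRep)) := by
  classical
  haveI : CompactSpace (absoluteGaloisGroup F) := absoluteGaloisGroup_compactSpace F
  haveI : CompactSpace (absInertia F) := isCompact_iff_compactSpace.mp (isClosed_absInertia_holds F).isCompact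
  set 𝔪 : Ideal ℤ_[p] := IsLocalRing.maximalIdeal ℤ_[p] with h𝔪
  set τI : ContinuousRep (absInertia F) ℤ_[p] D := τ.restrict (subgroupIncl (absInertia F)) with hτI
  -- the `p`-torsion submodule is finite and `D^∨` is finitely generated
  have hfin' : {d : D | (p : ℤ_[p]) • d = 0}.Finite :=
    hfin.subset fun d (hd : (p : ℤ_[p]) • d = 0) => show p • d = 0 by rwa [Nat.cast_smul_eq_nsmul] at hd
  haveI hBfin : Finite (Submodule.torsionBy ℤ_[p] D (p : ℤ_[p])) :=
    Set.finite_coe_iff.mpr (hfin'.subset fun d hd => (Submodule.mem_torsionBy_iff _ d).1 hd)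
  haveI hDfg : Module.Finite ℤ_[p] (CharacterModule D) :=
    module_finite_characterModule_of_torsion_finite (fun d => (hD d).imp fun k hk => padicInt_pow_smul_eq_zero hk) hfin'
  -- (a) `H¹(I_F, D[p])` is finite: transport from the `ℤ`-typed inertia bound
  have hsub : Module.Finite ℤ_[p] (CharacterModule (continuousCohomology 1
      (τI.subrepresentation (Submodule.torsionBy ℤ_[p] D (p : ℤ_[p])) (τI.torsionBy_smul_le_comap (p : ℤ_[p]))).toTopRep)) := by
    set B := Submodule.torsionBy ℤ_[p] D (p : ℤ_[p]) with hB
    let τB : ContinuousRep (absoluteGaloisGroup F) ℤ B :=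
      (τ.subrepresentation B (τ.torsionBy_smul_le_comap (p : ℤ_[p]))).restrictScalars ℤ
    have hBcop : (Nat.card B).Coprime (ringChar (IsLocalRing.ResidueField (ValuativeRel.valuation F).integer)) :=
      SignedLowerOffTwo.PTDeep.natCard_coprime_of_nsmul_eq_zero (ringChar_residueField_prime (F := F))
        ((Nat.coprime_primes Fact.out (ringChar_residueField_prime (F := F))).2 (Ne.symm hℓ)) fun b =>
          Subtype.ext (by
            rw [AddSubmonoidClass.coe_nsmul, ZeroMemClass.coe_zero, ← Nat.cast_smul_eq_nsmul ℤ_[p]]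
            exact (Submodule.mem_torsionBy_iff _ _).1 b.2)
    haveI hX : Finite (continuousCohomology 1 (τB.restrict (subgroupIncl (absInertia F))).toTopRep) :=
      (natCard_continuousCohomology_one_absInertia_le F τB hBcop).1
    let η : B ≃ₜ+ B := ContinuousAddEquiv.refl B
    have hη : ∀ (g : absInertia F) (x : B),
        η ((τB.restrict (subgroupIncl (absInertia F))).toTopRep.ρ g x) =
          (τI.subrepresentation B (τI.torsionBy_smul_le_comap (p : ℤ_[p]))).toTopRep.ρ g (η x) := fun _ _ => rfl
    haveI : Finite (continuousCohomology 1 (τI.subrepresentation B (τI.torsionBy_smul_le_comap (p : ℤ_[p]))).toTopRep) :=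
      Finite.of_equiv _ (continuousCohomologyAddEquiv (X := (τB.restrict (subgroupIncl (absInertia F))).toTopRep)
        (Y := (τI.subrepresentation B (τI.torsionBy_smul_le_comap (p : ℤ_[p]))).toTopRep) η hη 1).toEquiv
    haveI := finite_characterModule (continuousCohomology 1 (τI.subrepresentation B (τI.torsionBy_smul_le_comap (p : ℤ_[p]))).toTopRep)
    exact Module.Finite.of_finite
  -- (b) `H⁰(I_F, D/pD)` is finite
  have hquot : ∀ m : ℕ, m + 1 = 1 → Module.Finite ℤ_[p] (CharacterModule (continuousCohomology m
      (τI.quotient (LinearMap.range (DistribSMul.toLinearMap ℤ_[p] D (p : ℤ_[p])))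
        (τI.range_smul_le_comap (p : ℤ_[p]))).toTopRep)) := by
    intro m hm
    obtain rfl : m = 0 := by omega
    set W : Submodule ℤ_[p] D := LinearMap.range (DistribSMul.toLinearMap ℤ_[p] D (p : ℤ_[p])) with hW
    -- `(D/pD)^∨ ↪ D^∨` is finitely generated, and `D/pD` is killed by `𝔪 = (p)`, so `D/pD` is finite
    haveI : Module.Finite ℤ_[p] (CharacterModule (D ⧸ W)) := Module.Finite.of_injective (CharacterModule.dual W.mkQ)
      (CharacterModule.dual_injective_of_surjective _ (Submodule.mkQ_surjective W))
    haveI : Finite (D ⧸ W) :=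
      ContinuousRep.finite_of_forall_smul_eq_zero_of_module_finite_characterModule 𝔪 ![(p : ℤ_[p])]
        span_range_padic_eq_maximalIdeal fun k x => by
          fin_cases k
          obtain ⟨d, rfl⟩ := Submodule.mkQ_surjective W x
          change (p : ℤ_[p]) • W.mkQ d = 0
          rw [← map_smul, Submodule.mkQ_apply, Submodule.Quotient.mk_eq_zero]
          exact ⟨d, rfl⟩
    haveI := ContinuousRep.finite_continuousCohomology_zero (τI.quotient W (τI.range_smul_le_comap (p : ℤ_[p])))
    haveI := finite_characterModule (continuousCohomology 0 (τI.quotient W (τI.range_smul_le_comap (p : ℤ_[p]))).toTopRep)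
    exact Module.Finite.of_finite
  -- (c) dévissage: `(H¹(I_F, D)[p])^∨` finitely generated, hence `H¹(I_F, D)[p]` finite
  haveI hHp : Module.Finite ℤ_[p] (CharacterModule (Submodule.torsionBy ℤ_[p] (continuousCohomology 1 τI.toTopRep) (p : ℤ_[p]))) :=
    τI.module_finite_characterModule_torsionBy_continuousCohomology (p : ℤ_[p]) 1 hsub hquot
  haveI hfinHp : Finite (Submodule.torsionBy ℤ_[p] (continuousCohomology 1 τI.toTopRep) (p : ℤ_[p])) :=
    ContinuousRep.finite_of_forall_smul_eq_zero_of_module_finite_characterModule 𝔪 ![(p : ℤ_[p])]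
      span_range_padic_eq_maximalIdeal fun k x => by
        fin_cases k
        exact Subtype.ext ((Submodule.mem_torsionBy_iff _ _).1 x.2)
  -- (d) Nakayama for Pontryagin duals over `ℤ_p`
  have htors : ∀ s : continuousCohomology 1 τI.toTopRep, ∃ k : ℕ, ∀ r ∈ 𝔪 ^ k, r • s = 0 :=
    τI.exists_forall_mem_pow_smul_continuousCohomology_eq_zero 𝔪
      (fun d => (hD d).imp fun k hk => forall_mem_maximalIdeal_pow_smul_eq_zero hk) 1
  haveI : Finite (Submodule.torsionBySet ℤ_[p] (continuousCohomology 1 τI.toTopRep) (𝔪 : Set ℤ_[p])) := by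
    have h : Submodule.torsionBySet ℤ_[p] (continuousCohomology 1 τI.toTopRep) (𝔪 : Set ℤ_[p]) =
        Submodule.torsionBy ℤ_[p] (continuousCohomology 1 τI.toTopRep) (p : ℤ_[p]) := by
      rw [h𝔪, PadicInt.maximalIdeal_eq_span_p]
      exact Submodule.torsionBySet_span_singleton_eq _
    exact h ▸ hfinHp
  exact CharacterModule.module_finite_of_finite_torsionBySet 𝔪 (IsNoetherian.noetherian 𝔪) htors

end Inertia

/-! ## §5 The Frobenius annihilator on the inertia invariants modulo `c` -/

section Annihilator

open Literature.NumberTheory.GaloisRepresentations.IsNonarchimedeanLocalField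

variable (F : Type) [Field F] [ValuativeRel F] [TopologicalSpace F] [IsNonarchimedeanLocalField F]
  {p : ℕ} [Fact p.Prime]
  {𝒪 : Type*} [CommRing 𝒪] [TopologicalSpace 𝒪] [Algebra ℤ_[p] 𝒪]
  {A : Type} [AddCommGroup A] [Module 𝒪 A] [Module ℤ_[p] A] [IsScalarTower ℤ_[p] 𝒪 A]
  [TopologicalSpace A] [DiscreteTopology A]

/-- **THE ANNIHILATOR (over `ℤ_p`).** `F` a non-archimedean local field of residue characteristic `ℓ ≠ p`; `𝒪` a `ℤ_p`-algebra with
any topology; `A` a discrete `𝒪`-module, `p`-primary, with a continuous `𝒪`-linear action `ρ` of `Γ_F`; `c ∈ 𝒪` acting surjectively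
on `A` with `A[c][p]` finite. Then for every `d ∈ Γ_F` there is a MONIC `P ∈ ℤ_p[Y]` such that for every `I_F`-invariant `a ∈ A`,
`P(ρ d) a = c · a₀` with `a₀` `I_F`-invariant: `P(ρ(d)) · A^{I_F} ⊆ c · A^{I_F}`. See the module docstring for the proof
(`A^{I_F}/c ↪ H¹(I_F, A[c])`, cofinitely generated; `I_F ⊴ Γ_F`; Cayley–Hamilton on the Pontryagin dual).
[cite: JetchevSkinnerWan2017, §3.4, proof of Lemma 3.4.1 (arXiv:1512.06894 p. 14)] [cite: GreenbergVatsal2000, §2, proof of Prop. 2.4]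
[cite: SerreGaloisCohomology1997, I §2.2] [cite: Greenberg2006, §3 A, Prop. 3.2] -/
theorem exists_monic_aeval_restrictScalars_inertiaInvariants_mem
    (hℓ : ringChar (IsLocalRing.ResidueField (ValuativeRel.valuation F).integer) ≠ p)
    (ρ : ContinuousRep (absoluteGaloisGroup F) 𝒪 A) (c : 𝒪)
    (hA : ∀ a : A, ∃ k : ℕ, p ^ k • a = 0) (hdiv : ∀ a : A, ∃ b : A, c • b = a)
    (hfin : {a : A | c • a = 0 ∧ p • a = 0}.Finite) (d : absoluteGaloisGroup F) :
    ∃ P : Polynomial ℤ_[p], P.Monic ∧ ∀ a : A, (∀ i ∈ absInertia F, ρ i a = a) →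
      ∃ a₀ : A, (∀ i ∈ absInertia F, ρ i a₀ = a₀) ∧ c • a₀ = Polynomial.aeval ((ρ d).restrictScalars ℤ_[p]) P a := by
  classical
  haveI : CompactSpace (absoluteGaloisGroup F) := absoluteGaloisGroup_compactSpace F
  haveI hnormal : (absInertia F).Normal := absInertia_normal_holds F
  -- the `ℤ_p`-typed representations on `A` and `D = A[c]`, restricted to `I_F`
  haveI : ContinuousSMul ℤ_[p] A := SigmaLocal.continuousSMul_padicInt_of_discrete hA
  set D : Submodule 𝒪 A := Submodule.torsionBy 𝒪 A c with hD
  have hDp : ∀ x : D, ∃ k : ℕ, p ^ k • x = 0 := fun x => (hA x.1).imp fun k hk =>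
    Subtype.ext (by rw [AddSubmonoidClass.coe_nsmul, hk, ZeroMemClass.coe_zero])
  haveI : ContinuousSMul ℤ_[p] D := SigmaLocal.continuousSMul_padicInt_of_discrete hDp
  set ι := Literature.NumberTheory.GaloisRepresentations.subgroupIncl (absInertia F) with hι
  set ρR : ContinuousRep (absoluteGaloisGroup F) ℤ_[p] A := ρ.restrictScalars ℤ_[p] with hρR
  set ρ₁ : ContinuousRep (absoluteGaloisGroup F) ℤ_[p] D := (torsionRep ρ c).restrictScalars ℤ_[p] with hρ₁
  set ρRI : ContinuousRep (absInertia F) ℤ_[p] A := ρR.restrict ι with hρRI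
  set ρ₁I : ContinuousRep (absInertia F) ℤ_[p] D := ρ₁.restrict ι with hρ₁I
  -- `H¹(I_F, A[c])^∨` is finitely generated (§4)
  haveI hH : Module.Finite ℤ_[p] (CharacterModule (continuousCohomology 1 ρ₁I.toTopRep)) := by
    refine module_finite_characterModule_h1_absInertia F hℓ ρ₁ hDp ?_
    have hinj : Set.InjOn (fun x : D => (x : A)) {x : D | p • x = 0} := fun x _ y _ hxy => Subtype.ext hxy
    refine Set.Finite.of_finite_image (hfin.subset ?_) hinj
    rintro _ ⟨x, hx, rfl⟩
    refine ⟨(Submodule.mem_torsionBy_iff c (x : A)).1 x.2, ?_⟩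
    have hx' : p • x = 0 := hx
    have := congrArg (fun y : D => (y : A)) hx'
    simpa only [AddSubmonoidClass.coe_nsmul, ZeroMemClass.coe_zero] using this
  -- the short exact sequence `0 → A[c] → A →(c·) A → 0` over `I_F`
  let f : ρ₁I.toTopRep ⟶ ρRI.toTopRep := TopRep.ofHom
    { toLinearMap := D.subtype.restrictScalars ℤ_[p]
      cont := continuous_subtype_val
      isIntertwining' := fun _ => rfl }
  let g : ρRI.toTopRep ⟶ ρRI.toTopRep := TopRep.ofHom
    { toLinearMap := (DistribSMul.toLinearMap 𝒪 A c).restrictScalars ℤ_[p]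
      cont := continuous_of_discreteTopology
      isIntertwining' := fun σ => by
        refine ContinuousLinearMap.ext fun a => ?_
        change c • ρ (σ : absoluteGaloisGroup F) a = ρ (σ : absoluteGaloisGroup F) (c • a)
        rw [map_smul] }
  have hSES : IsSES f g :=
    { comp_eq_zero := by
        ext x
        change c • ((x : D) : A) = 0
        exact (Submodule.mem_torsionBy_iff c (x : A)).1 x.2
      injective := Subtype.val_injective
      exact_mid := fun y hy => ⟨⟨y, (Submodule.mem_torsionBy_iff c y).2 hy⟩, rfl⟩
      surjective := hdiv }
  -- the invariants `N₀ = A^{I_F}` (a `ℤ_p`-submodule) and the two commuting endomorphisms `ρ(d)|N₀`, `c·|N₀`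
  set N₀ : Submodule ℤ_[p] A := ρRI.toTopRep.ρ.invariants with hN₀
  have hmemN₀ : ∀ a : A, a ∈ N₀ ↔ ∀ i ∈ absInertia F, ρ i a = a := fun a => by
    rw [hN₀, ContRepresentation.mem_invariants]
    exact ⟨fun h i hi => h ⟨i, hi⟩, fun h i => h i.1 i.2⟩
  have hδN : ∀ v ∈ N₀, (ρ d).restrictScalars ℤ_[p] v ∈ N₀ := fun v hv => by
    rw [hmemN₀] at hv ⊢
    intro i hi
    have hconj : d⁻¹ * i * d ∈ absInertia F := by simpa only [inv_inv] using hnormal.conj_mem i hi d⁻¹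
    change ρ i (ρ d v) = ρ d v
    rw [← Module.End.mul_apply, ← map_mul, show i * d = d * (d⁻¹ * i * d) by group, map_mul,
      Module.End.mul_apply, hv _ hconj]
  have hγN : ∀ v ∈ N₀, (DistribSMul.toLinearMap 𝒪 A c).restrictScalars ℤ_[p] v ∈ N₀ := fun v hv => by
    rw [hmemN₀] at hv ⊢
    intro i hi
    change ρ i (c • v) = c • v
    rw [map_smul, hv i hi]
  set δN : Module.End ℤ_[p] N₀ := ((ρ d).restrictScalars ℤ_[p]).restrict hδN with hδNdef
  set γN : Module.End ℤ_[p] N₀ := ((DistribSMul.toLinearMap 𝒪 A c).restrictScalars ℤ_[p]).restrict hγN with hγNdef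
  have hcomm : ∀ v : N₀, δN (γN v) = γN (δN v) := fun v => Subtype.ext (map_smul (ρ d) c (v : A))
  -- the connecting homomorphism `δ₀ : N₀ → H¹(I_F, A[c])` has kernel `c · N₀`
  have hker : ∀ v : N₀, hSES.δ₀ v = 0 ↔ v ∈ LinearMap.range γN := fun v => by
    rw [hSES.δ₀_eq_zero_iff]
    exact ⟨fun ⟨w, hw, hwv⟩ => ⟨⟨w, hw⟩, Subtype.ext hwv⟩, fun ⟨w, hw⟩ => ⟨w, w.2, hw ▸ rfl⟩⟩
  -- Cayley–Hamilton on the dual (§2)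
  obtain ⟨P, hPmon, hP⟩ := exists_monic_forall_exists_eq_aeval_of_ker_eq δN γN hcomm hSES.δ₀ hker
  refine ⟨P, hPmon, fun a ha => ?_⟩
  obtain ⟨v₀, hv₀⟩ := hP ⟨a, (hmemN₀ a).2 ha⟩
  refine ⟨v₀, (hmemN₀ _).1 v₀.2, ?_⟩
  have h1 : c • (v₀ : A) = ((Polynomial.aeval δN P ⟨a, (hmemN₀ a).2 ha⟩ : N₀) : A) :=
    congrArg (fun y : N₀ => (y : A)) hv₀
  rw [h1]
  exact apply_aeval_eq_aeval_apply δN ((ρ d).restrictScalars ℤ_[p]) N₀.subtype (fun _ => rfl) P _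

end Annihilator

end Summit.BirchSwinnertonDyer.BirchSwinnertonDyer.Theorems.TelescopeK2InertiaFrobeniusAnnihilator

end
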